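import Literature.MathematicalPhysics.StatisticalMechanics.LennardJonesClusters
import Mathlib.MeasureTheory.Integral.IntervalIntegral.Basic
import Mathlib.Analysis.SpecialFunctions.Exp

/-!
# Route `ThreeConeCertificate` — posited objects: the explicit Bernstein/Gaussian split of `V_LJ`

Objects of the line `Sketch` for the crux `OnePercentCertificate` (stmt-AtomisticToContinuum-11958):
an explicit three-cone split `V_LJ = gS + US + fS` on `(0,∞)` in Gaussian/Bernstein coordinates
(crux cards `bernstein-coordinates`, `imq-bochner-dictionary`; line file
`Cruxes/OnePercentCertificate/Lines/Sketch.lean`).  Tree units `V_LJ = r⁻¹²/12 − r⁻⁶/6`.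

* `bernsteinTail T r = ∫₀ᵀ t² e^{−t r²} dt` — the exact Bernstein piece of the van der Waals tail
  (`(1/12)∫₀^∞ t² e^{−t r²} dt = r⁻⁶/6`), finite at `r = 0` (`T³/3`).
* `fS r = A e^{−a r²} − B e^{−b r²} − (1/12)·bernsteinTail T r` with
  `(A, a, B, b, T) = (21997/100000, 169/100, 3/1000, 81/100, 36/25)`: the Bochner part (nested
  design `b ≤ T ≤ a`, so positive type is the single rational inequality
  `A a^{-3/2} ≥ B b^{-3/2} + T^{3/2}/18`, i.e. `21997/219700 ≥ 3/729 + 12/125`).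
* `gS = (V_LJ − fS)·1_{r < 5/2}` (finite range `5/2`), `US = (V_LJ − fS)·1_{5/2 ≤ r}` (slack),
  `cS = 29/40 − fS 0 / 2 ≈ 0.657987` (the local constant the line must certify; the close packings
  reach `−0.651258` per particle in `gS`-energy at scale `0.9715`, margin `0.00673`).

Definitions only (no statements); the stubs and the composition live in the line's Theorems files.
-/

noncomputable section

namespace Summit.AtomisticToContinuum.Crystallization.Theorems.ThreeConeSplit

open Literature.MathematicalPhysics.StatisticalMechanics

/-- The Bernstein tail piece `∫₀ᵀ t² e^{−t r²} dt` of the split (`(1/12)·bernsteinTail T r ↑ r⁻⁶/6`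
as `T → ∞` for `r > 0`; value `T³/3` at `r = 0`). [folklore] -/
def bernsteinTail (T r : ℝ) : ℝ := ∫ t in (0 : ℝ)..T, t ^ 2 * Real.exp (-t * r ^ 2)

/-- The Bochner part of the split: `fS r = A e^{−a r²} − B e^{−b r²} − (1/12)∫₀ᵀ t² e^{−t r²} dt`
with `(A, a, B, b, T) = (21997/100000, 169/100, 3/1000, 81/100, 36/25)`. [folklore] -/
def fS (r : ℝ) : ℝ :=
  21997 / 100000 * Real.exp (-(169 / 100) * r ^ 2) - 3 / 1000 * Real.exp (-(81 / 100) * r ^ 2)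
    - 1 / 12 * bernsteinTail (36 / 25) r

/-- The finite-range part of the split: `gS = (V_LJ − fS)·1_{r < 5/2}`. [folklore] -/
def gS (r : ℝ) : ℝ := if r < 5 / 2 then lennardJones r - fS r else 0

/-- The slack part of the split: `US = (V_LJ − fS)·1_{5/2 ≤ r}`. [folklore] -/
def US (r : ℝ) : ℝ := if r < 5 / 2 then 0 else lennardJones r - fS r

/-- The local constant of the split: `cS = 29/40 − fS 0 / 2` (`≈ 0.657987`), so that
`cS + fS 0 / 2 = 29/40` by definition. [folklore] -/
def cS : ℝ := 29 / 40 - fS 0 / 2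

/-- The decomposition `V_LJ = gS + US + fS` holds identically (by the case split in `gS`, `US`).
[folklore] -/
theorem lennardJones_eq_gS_add_US_add_fS (r : ℝ) : lennardJones r = gS r + US r + fS r := by
  simp only [gS, US]
  split_ifs <;> ring

/-- `gS` vanishes on `[5/2, ∞)`. [folklore] -/
theorem gS_eq_zero {r : ℝ} (hr : 5 / 2 ≤ r) : gS r = 0 := by
  simp only [gS, if_neg (not_lt.2 hr)]

/-- The value of the split is `29/40` by definition of `cS`. [folklore] -/
theorem cS_add_fS_zero_div_two : cS + fS 0 / 2 = 29 / 40 := by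
  simp only [cS]
  ring

end Summit.AtomisticToContinuum.Crystallization.Theorems.ThreeConeSplit
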